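import Mathlib
import Literature.Analysis.FluidPDE.VectorCalculus
import Literature.Analysis.FluidPDE.DifferentiableGaussGreen
import Summits.NavierStokesRegularity.NavierStokesRegularity.Theorems.UnthreadedDoorFluxStarvedDipolePotentialCalculus
import Summits.NavierStokesRegularity.NavierStokesRegularity.Theorems.ThreadingFluxHorizonTowerZonalFrame
import HarnessLib

/-!
# Route `UnthreadedDoor`, crux `PoloidalLiouville` (stmt-NavierStokesRegularity-1222), wall W1 — crux idea
# «flux-starved-dipoles» (ns-idea-15 g12/g13, `Cruxes/PoloidalLiouville/FluxStarvedDipoleSketch.lean`):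
# the MOVING SPHERICAL FRAME of a turning-axis dipole (first of three files proving `FluxStarvationSteady` and K1)

The remaining input of the sketch Prop `FluxStarvationSteady` after p837304/p837414/p837567 was the latitude-independence
identity `(a − r a′)·M = −r²ℓ` (card §Proof step 3).  It is proved in the sequel `…FluxStarvedDipoleLatitudeIdentity` by a
POINTWISE route — incompressibility written in the moving orthonormal frame `(ξ̂, θ̂, φ̂)` of the axis `Â(r)` at a point of the
dipolar sphere, the azimuthal component of the steady kinematic law, and one integration `∮ ∂_φ u_φ dφ = 0` — which needs no
`r`-derivatives of the loop momentum and no turning frame.  THIS FILE supplies the frame algebra and the one-variable calculus: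

* `pairFrame_facts`, `movingFrame_facts` — the frame `(n, ρ, n × ρ)` of an orthonormal pair and the moving frame
  `ξ̂ = c n + s ρ`, `θ̂ = −s n + c ρ` (`c² + s² = 1`), `ξ̂ × θ̂ = n × ρ`; `divergence_pairFrame` — `div u` as the trace of `Du`
  in such a frame (`divergence_eq_sum_inner_fderiv` with `HorizonTower.Zonal.frameBasis`);
* `law_azimuthal` — the `φ̂`-component of `∇L × y = ∇m × ∇T` with `∇T = α n + κ y` on the sphere:
  `r²⟪∇L, θ̂⟫ = ⟪∇T, y⟫⟪∇m, θ̂⟫ + rα s⟪∇m, ξ̂⟫`; `meridional_drift` — `a s·u_θ = ⟪∇T, y⟫ m/r − r⟪u, ∇T⟫`;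
* `dipole_fderiv_radial` — `DT(x)[x − x₀] = ⟪A′(r), x − x₀⟫ + r R′(r)`; `deriv_norm_eq_inner_unit` — `(‖A‖)′ = ⟪A′, Â⟫`;
* `norm_meridianVec`, `hasDerivAt_meridianVec`, `hasDerivAt_thetaHat` — the meridian `θ ↦ r cos θ·n + r sin θ·ρ`, its velocity
  `r θ̂` and `dθ̂/dθ = −ξ̂`.

HONEST LABEL: vector calculus in the LINEAR kinematic shadow of W1 (critic V28: information-grade, W1 movement 0);
`PoloidalLiouville` (1222), its wall `stub_scalarLiouville` and the summit stay OPEN; NO Navier–Stokes regularity statement is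
proved.  `--supports stmt-NavierStokesRegularity-1222` (helper).  [folklore]
-/

noncomputable section

-- the summit and its single sub-problem share the name (CONVENTIONS §1)
set_option linter.dupNamespace false

open Set Filter Topology InnerProductSpace
open scoped RealInnerProductSpace Laplacian
open Literature.Analysis.FluidPDE
open Summit.NavierStokesRegularity.NavierStokesRegularity.Theorems.PoloidalLiouville.HorizonTower (E3)
open Summit.NavierStokesRegularity.NavierStokesRegularity.Theorems.PoloidalLiouville.KinematicShadow (PointSource.cross_smul_right
  PointSource.cross_add_right PointSource.cross_self PointSource.cross_anticomm)
open Summit.NavierStokesRegularity.NavierStokesRegularity.Theorems.PoloidalLiouville.HorizonTower.Zonal (inner_cross_self_left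
  inner_cross_self_right norm_cross_sq cross_cross_left_of_orthonormal cross_cross_right_of_orthonormal frameBasis
  frameBasis_apply frameVec_zero frameVec_one frameVec_two)

namespace Summit.NavierStokesRegularity.NavierStokesRegularity.Theorems.PoloidalLiouville.FluxStarvedDipole

/-! ### The spherical frame of an orthonormal pair -/

/-- Frame products of an orthonormal pair `(n, ρ)` with `p = n × ρ`: `‖p‖ = 1`, `p ⊥ n`, `p ⊥ ρ`, `n × p = −ρ`, `ρ × p = n`.
[folklore] -/
theorem pairFrame_facts {n ρ : E3} (hn : ‖n‖ = 1) (hρ : ‖ρ‖ = 1) (hnρ : ⟪n, ρ⟫ = 0) :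
    ‖cross n ρ‖ = 1 ∧ ⟪cross n ρ, n⟫ = 0 ∧ ⟪cross n ρ, ρ⟫ = 0 ∧ cross n (cross n ρ) = -ρ ∧
      cross ρ (cross n ρ) = n := by
  refine ⟨?_, inner_cross_self_left n ρ, inner_cross_self_right n ρ, ?_, ?_⟩
  · have h := norm_cross_sq n ρ
    rw [hn, hρ, hnρ] at h
    nlinarith [norm_nonneg (cross n ρ)]
  · rw [PointSource.cross_anticomm n (cross n ρ), cross_cross_left_of_orthonormal hn hnρ]
  · rw [PointSource.cross_anticomm ρ (cross n ρ), cross_cross_right_of_orthonormal hρ hnρ, neg_neg]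

/-- The moving frame on the sphere: for an orthonormal pair `(n, ρ)` and `c² + s² = 1`, the radial and meridional unit vectors
`ξ̂ = c n + s ρ`, `θ̂ = −s n + c ρ` are orthonormal and `ξ̂ × θ̂ = n × ρ` (the azimuthal unit vector). [folklore] -/
theorem movingFrame_facts {n ρ : E3} (hn : ‖n‖ = 1) (hρ : ‖ρ‖ = 1) (hnρ : ⟪n, ρ⟫ = 0) {c s : ℝ}
    (hcs : c ^ 2 + s ^ 2 = 1) :
    ‖c • n + s • ρ‖ = 1 ∧ ‖(-s) • n + c • ρ‖ = 1 ∧ ⟪c • n + s • ρ, (-s) • n + c • ρ⟫ = 0 ∧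
      cross (c • n + s • ρ) ((-s) • n + c • ρ) = cross n ρ := by
  have hnn : ⟪n, n⟫ = 1 := by rw [real_inner_self_eq_norm_sq, hn, one_pow]
  have hρρ : ⟪ρ, ρ⟫ = 1 := by rw [real_inner_self_eq_norm_sq, hρ, one_pow]
  have hρn : ⟪ρ, n⟫ = 0 := by rw [real_inner_comm]; exact hnρ
  have h1 : ‖c • n + s • ρ‖ ^ 2 = 1 := by
    rw [← real_inner_self_eq_norm_sq]
    simp only [inner_add_left, inner_add_right, real_inner_smul_left, real_inner_smul_right, hnn, hρρ, hnρ, hρn]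
    linear_combination hcs
  have h2 : ‖(-s) • n + c • ρ‖ ^ 2 = 1 := by
    rw [← real_inner_self_eq_norm_sq]
    simp only [inner_add_left, inner_add_right, real_inner_smul_left, real_inner_smul_right, hnn, hρρ, hnρ, hρn]
    linear_combination hcs
  refine ⟨?_, ?_, ?_, ?_⟩
  · nlinarith [norm_nonneg (c • n + s • ρ)]
  · nlinarith [norm_nonneg ((-s) • n + c • ρ)]
  · simp only [inner_add_left, inner_add_right, real_inner_smul_left, real_inner_smul_right, hnn, hρρ, hnρ, hρn]
    ring
  · have cross_add_left' : ∀ v w z : E3, cross (v + w) z = cross v z + cross w z := fun v w z => by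
      rw [← crossCLM_apply, ← crossCLM_apply, ← crossCLM_apply, map_add]; rfl
    rw [cross_add_left', cross_smul_left, cross_smul_left, PointSource.cross_add_right, PointSource.cross_add_right,
      PointSource.cross_smul_right, PointSource.cross_smul_right, PointSource.cross_smul_right,
      PointSource.cross_smul_right, PointSource.cross_self, PointSource.cross_self, PointSource.cross_anticomm ρ n]
    have : c • (c • cross n ρ) + s • ((-s) • -cross n ρ) = (c ^ 2 + s ^ 2) • cross n ρ := by module
    rw [smul_zero, smul_zero, zero_add, add_zero, this, hcs, one_smul]

/-- **The divergence in a moving frame**: for an orthonormal pair `(v, w)` the divergence of `u` at `x` is the trace of `Du(x)`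
in the orthonormal basis `(v, w, v × w)`. [folklore] -/
theorem divergence_pairFrame (u : E3 → E3) (x : E3) {v w : E3} (hv : ‖v‖ = 1) (hw : ‖w‖ = 1) (hvw : ⟪v, w⟫ = 0) :
    VectorCalculus.divergence u x =
      ⟪v, fderiv ℝ u x v⟫ + ⟪w, fderiv ℝ u x w⟫ + ⟪cross v w, fderiv ℝ u x (cross v w)⟫ := by
  rw [divergence_eq_sum_inner_fderiv (frameBasis hv hw hvw), Fin.sum_univ_three, frameBasis_apply, frameBasis_apply,
    frameBasis_apply, frameVec_zero, frameVec_one, frameVec_two]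

/-! ### The azimuthal component of the steady kinematic law, and the meridional drift -/

/-- **Azimuthal component of the law.**  At the point `y = r c n + r s ρ` of `S_r` (orthonormal pair `(n, ρ)`, `c² + s² = 1`),
if `gL × y = gm × gT` with `gT = α n + κ y` (the shape of `∇T` on a dipolar sphere, `α = ‖A(r)‖/r`), then pairing with the
azimuthal vector `n × ρ` gives `r²⟪gL, θ̂⟫ = ⟪gT, y⟫·⟪gm, θ̂⟫ + rα s·⟪gm, ξ̂⟫` (`ξ̂ = c n + s ρ`, `θ̂ = −s n + c ρ`).
[folklore] -/
theorem law_azimuthal {n ρ : E3} (hn : ‖n‖ = 1) (hρ : ‖ρ‖ = 1) (hnρ : ⟪n, ρ⟫ = 0) {c s : ℝ}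
    (hcs : c ^ 2 + s ^ 2 = 1) (r α κ : ℝ) (gL gm : E3)
    (hlaw : cross gL ((r * c) • n + (r * s) • ρ) =
      cross gm (α • n + κ • ((r * c) • n + (r * s) • ρ))) :
    r * (r * ⟪gL, (-s) • n + c • ρ⟫) =
      ⟪α • n + κ • ((r * c) • n + (r * s) • ρ), (r * c) • n + (r * s) • ρ⟫ * ⟪gm, (-s) • n + c • ρ⟫
        + r * α * s * ⟪gm, c • n + s • ρ⟫ := by
  obtain ⟨-, -, -, hnp, hρp⟩ := pairFrame_facts hn hρ hnρ
  have hnn : ⟪n, n⟫ = 1 := by rw [real_inner_self_eq_norm_sq, hn, one_pow]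
  have hρρ : ⟪ρ, ρ⟫ = 1 := by rw [real_inner_self_eq_norm_sq, hρ, one_pow]
  have hρn : ⟪ρ, n⟫ = 0 := by rw [real_inner_comm]; exact hnρ
  -- pair both sides with `p = n × ρ`
  have h : ⟪cross gL ((r * c) • n + (r * s) • ρ), cross n ρ⟫ =
      ⟪cross gm (α • n + κ • ((r * c) • n + (r * s) • ρ)), cross n ρ⟫ := by rw [hlaw]
  have cross_add_left' : ∀ v w z : E3, cross (v + w) z = cross v z + cross w z := fun v w z => by
    rw [← crossCLM_apply, ← crossCLM_apply, ← crossCLM_apply, map_add]; rfl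
  rw [← inner_cross_right_eq_inner_cross_left, ← inner_cross_right_eq_inner_cross_left, cross_add_left',
    cross_smul_left, cross_smul_left, hnp, hρp, cross_add_left', cross_smul_left, cross_smul_left, hnp,
    cross_add_left', cross_smul_left, cross_smul_left, hnp, hρp] at h
  simp only [inner_add_right, inner_smul_right, inner_neg_right] at h
  simp only [inner_add_left, inner_add_right, real_inner_smul_left, real_inner_smul_right, hnn, hρρ, hnρ, hρn]
  linear_combination (-r) * h + (κ * r ^ 2 * s * ⟪gm, n⟫ - (r * α + κ * r ^ 2 * c) * ⟪gm, ρ⟫) * hcs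

/-- **The meridional drift from the reduced scalar.**  With `gT = α n + κ y` at `y = r c n + r s ρ` and any vector `U`:
`r²⟪U, gT⟫ = ⟪gT, y⟫⟪U, y⟫ − r²α s·⟪U, θ̂⟫` — i.e. `a s·u_θ = ⟪∇T, y⟫·m/r − r⟪u, ∇T⟫` on a dipolar sphere (`a = rα`).
[folklore] -/
theorem meridional_drift {n ρ : E3} (hn : ‖n‖ = 1) (hρ : ‖ρ‖ = 1) (hnρ : ⟪n, ρ⟫ = 0) {c s : ℝ}
    (hcs : c ^ 2 + s ^ 2 = 1) (r α κ : ℝ) (U : E3) :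
    r * (r * ⟪U, α • n + κ • ((r * c) • n + (r * s) • ρ)⟫) =
      ⟪α • n + κ • ((r * c) • n + (r * s) • ρ), (r * c) • n + (r * s) • ρ⟫ * ⟪U, (r * c) • n + (r * s) • ρ⟫
        - r * (r * α * s * ⟪U, (-s) • n + c • ρ⟫) := by
  have hnn : ⟪n, n⟫ = 1 := by rw [real_inner_self_eq_norm_sq, hn, one_pow]
  have hρρ : ⟪ρ, ρ⟫ = 1 := by rw [real_inner_self_eq_norm_sq, hρ, one_pow]
  have hρn : ⟪ρ, n⟫ = 0 := by rw [real_inner_comm]; exact hnρ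
  simp only [inner_add_left, inner_add_right, real_inner_smul_left, real_inner_smul_right, hnn, hρρ, hnρ, hρn]
  linear_combination (-(α * r ^ 2 * ⟪U, n⟫ + κ * r ^ 3 * (c * ⟪U, n⟫ + s * ⟪U, ρ⟫))) * hcs

/-! ### Radial calculus of the dipole potential and of the moment curve -/

/-- Along the line `t ↦ p + t w` through `p ≠ x₀`, the distance to `x₀` has derivative `⟪p − x₀, w⟫/‖p − x₀‖` at `t = 0`.
[folklore] -/
theorem hasDerivAt_norm_line_inner {x₀ p w : E3} (hp : p ≠ x₀) :
    HasDerivAt (fun t : ℝ => ‖p + t • w - x₀‖) (⟪p - x₀, w⟫ / ‖p - x₀‖) 0 := by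
  have hℓ : HasDerivAt (fun t : ℝ => p + t • w - x₀) w 0 := by
    have h := (((hasDerivAt_id' (0 : ℝ)).smul_const w).const_add p).sub_const x₀
    simpa only [one_smul] using h
  have hsq := hℓ.norm_sq
  have hne : ‖p + (0 : ℝ) • w - x₀‖ ^ 2 ≠ 0 := by
    rw [zero_smul, add_zero]
    exact pow_ne_zero 2 (norm_ne_zero_iff.mpr (sub_ne_zero.mpr hp))
  have h := hsq.sqrt hne
  have hfun : (fun t : ℝ => Real.sqrt (‖p + t • w - x₀‖ ^ 2)) = fun t => ‖p + t • w - x₀‖ :=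
    funext fun t => Real.sqrt_sq (norm_nonneg _)
  rw [hfun] at h
  refine h.congr_deriv ?_
  rw [zero_smul, add_zero, Real.sqrt_sq (norm_nonneg _)]
  have h0 : ‖p - x₀‖ ≠ 0 := norm_ne_zero_iff.mpr (sub_ne_zero.mpr hp)
  field_simp

/-- **Radial derivative of the dipole potential**: for `T(x) = ⟪A(‖x−x₀‖), x−x₀⟫/‖x−x₀‖ + R(‖x−x₀‖)` with `A, R ∈ C³(0,∞)` and
`x ≠ x₀`, `DT(x)[x − x₀] = ⟪A′(‖x−x₀‖), x−x₀⟫ + ‖x−x₀‖·R′(‖x−x₀‖)` (differentiate `t ↦ T(x + t(x−x₀))` at `t = 0`). [folklore] -/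
theorem dipole_fderiv_radial {A : ℝ → E3} {R : ℝ → ℝ} {x₀ x : E3} {T : E3 → ℝ}
    (hT : ∀ z, T z = ⟪A ‖z - x₀‖, z - x₀⟫ / ‖z - x₀‖ + R ‖z - x₀‖)
    (hA : ContDiffOn ℝ 3 A (Ioi 0)) (hR : ContDiffOn ℝ 3 R (Ioi 0)) (hx : x ≠ x₀) :
    fderiv ℝ T x (x - x₀) = ⟪deriv A ‖x - x₀‖, x - x₀⟫ + ‖x - x₀‖ * deriv R ‖x - x₀‖ := by
  set w : E3 := x - x₀ with hw
  have hne : w ≠ 0 := sub_ne_zero.mpr hx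
  have hpos : ‖w‖ ∈ Ioi (0 : ℝ) := norm_pos_iff.mpr hne
  have hw0 : ‖w‖ ≠ 0 := norm_ne_zero_iff.mpr hne
  -- the line `t ↦ x + t w`
  have hℓ : HasDerivAt (fun t : ℝ => x + t • w) w 0 := by
    have h := ((hasDerivAt_id' (0 : ℝ)).smul_const w).const_add x
    simpa only [one_smul] using h
  have hℓ' : HasDerivAt (fun t : ℝ => x + t • w - x₀) w 0 := hℓ.sub_const x₀
  have h0 : x + (0 : ℝ) • w = x := by rw [zero_smul, add_zero]
  have h0' : x + (0 : ℝ) • w - x₀ = w := by rw [h0]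
  -- `DT(x)[w]` is the derivative of `T` along the line
  have hTd : DifferentiableAt ℝ T x := (dipole_contDiffAt hT hA hR hx).differentiableAt (by norm_num)
  have hcomp : HasDerivAt (fun t : ℝ => T (x + t • w)) (fderiv ℝ T x w) 0 := by
    have hF : HasFDerivAt T (fderiv ℝ T x) (x + (0 : ℝ) • w) := by rw [h0]; exact hTd.hasFDerivAt
    exact hF.comp_hasDerivAt (0 : ℝ) hℓ
  -- the explicit derivative along the line
  have hN : HasDerivAt (fun t : ℝ => ‖x + t • w - x₀‖) (⟪x - x₀, w⟫ / ‖x - x₀‖) 0 := hasDerivAt_norm_line_inner hx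
  have hNval : ⟪x - x₀, w⟫ / ‖x - x₀‖ = ‖w‖ := by
    rw [← hw, real_inner_self_eq_norm_sq]; field_simp
  rw [hNval] at hN
  have hAd : HasDerivAt A (deriv A ‖x + (0 : ℝ) • w - x₀‖) ‖x + (0 : ℝ) • w - x₀‖ := by
    rw [h0']
    exact ((hA.differentiableOn (by norm_num)).differentiableAt (Ioi_mem_nhds hpos)).hasDerivAt
  have hRd : HasDerivAt R (deriv R ‖x + (0 : ℝ) • w - x₀‖) ‖x + (0 : ℝ) • w - x₀‖ := by
    rw [h0']
    exact ((hR.differentiableOn (by norm_num)).differentiableAt (Ioi_mem_nhds hpos)).hasDerivAt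
  have hAN : HasDerivAt (fun t : ℝ => A ‖x + t • w - x₀‖) (‖w‖ • deriv A ‖x + (0 : ℝ) • w - x₀‖) 0 :=
    hAd.scomp (0 : ℝ) hN
  have hRN : HasDerivAt (fun t : ℝ => R ‖x + t • w - x₀‖) (deriv R ‖x + (0 : ℝ) • w - x₀‖ * ‖w‖) 0 :=
    hRd.comp (0 : ℝ) hN
  have hI := hAN.inner ℝ hℓ'
  have hN0 : ‖x + (0 : ℝ) • w - x₀‖ ≠ 0 := by rw [h0']; exact hw0
  have hexp := (hI.div hN hN0).add hRN
  have hfun : (fun t : ℝ => T (x + t • w)) =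
      fun t => ⟪A ‖x + t • w - x₀‖, x + t • w - x₀⟫ / ‖x + t • w - x₀‖ + R ‖x + t • w - x₀‖ :=
    funext fun t => hT _
  rw [hfun] at hcomp
  rw [hcomp.unique hexp, h0', real_inner_smul_left]
  field_simp
  ring

/-- The derivative of the moment size: for `A` differentiable at `r` with `A(r) ≠ 0`,
`(‖A‖)′(r) = ⟪A′(r), Â(r)⟫`, `Â = A/‖A‖`. [folklore] -/
theorem deriv_norm_eq_inner_unit {A : ℝ → E3} {r : ℝ} (hA : DifferentiableAt ℝ A r) (hAr : A r ≠ 0) :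
    deriv (fun s => ‖A s‖) r = ⟪deriv A r, ‖A r‖⁻¹ • A r⟫ := by
  have hsq := hA.hasDerivAt.norm_sq
  have hne : ‖A r‖ ^ 2 ≠ 0 := pow_ne_zero 2 (norm_ne_zero_iff.mpr hAr)
  have h := hsq.sqrt hne
  have hfun : (fun s : ℝ => Real.sqrt ((‖A ·‖ ^ 2) s)) = fun s => ‖A s‖ :=
    funext fun s => Real.sqrt_sq (norm_nonneg _)
  rw [hfun] at h
  rw [h.deriv]
  rw [Real.sqrt_sq (norm_nonneg _), real_inner_smul_right, real_inner_comm]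
  have h0 : ‖A r‖ ≠ 0 := norm_ne_zero_iff.mpr hAr
  field_simp

/-! ### Meridians and their frames -/

/-- A point of the meridian `θ ↦ r cos θ·n + r sin θ·ρ` of an orthonormal pair lies on the sphere of radius `r ≥ 0`. [folklore] -/
theorem norm_meridianVec {n ρ : E3} (hn : ‖n‖ = 1) (hρ : ‖ρ‖ = 1) (hnρ : ⟪n, ρ⟫ = 0) {r : ℝ} (hr : 0 ≤ r)
    (θ : ℝ) : ‖(r * Real.cos θ) • n + (r * Real.sin θ) • ρ‖ = r := by
  have h := (movingFrame_facts hn hρ hnρ (Real.cos_sq_add_sin_sq θ)).1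
  have : (r * Real.cos θ) • n + (r * Real.sin θ) • ρ = r • (Real.cos θ • n + Real.sin θ • ρ) := by
    rw [smul_add, smul_smul, smul_smul]
  rw [this, norm_smul, h, mul_one, Real.norm_of_nonneg hr]

/-- Velocity of the meridian: `d/dθ (r cos θ·n + r sin θ·ρ) = r·θ̂`, `θ̂ = −sin θ·n + cos θ·ρ`. [folklore] -/
theorem hasDerivAt_meridianVec (n ρ : E3) (r θ : ℝ) :
    HasDerivAt (fun θ : ℝ => (r * Real.cos θ) • n + (r * Real.sin θ) • ρ)
      (r • ((-Real.sin θ) • n + Real.cos θ • ρ)) θ := by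
  have h1 : HasDerivAt (fun θ : ℝ => (r * Real.cos θ) • n) ((r * -Real.sin θ) • n) θ :=
    ((Real.hasDerivAt_cos θ).const_mul r).smul_const n
  have h2 : HasDerivAt (fun θ : ℝ => (r * Real.sin θ) • ρ) ((r * Real.cos θ) • ρ) θ :=
    ((Real.hasDerivAt_sin θ).const_mul r).smul_const ρ
  exact (h1.add h2).congr_deriv (by module)

/-- Derivative of the meridional unit vector: `d/dθ θ̂ = −ξ̂`, `ξ̂ = cos θ·n + sin θ·ρ`. [folklore] -/
theorem hasDerivAt_thetaHat (n ρ : E3) (θ : ℝ) :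
    HasDerivAt (fun θ : ℝ => (-Real.sin θ) • n + Real.cos θ • ρ) (-(Real.cos θ • n + Real.sin θ • ρ)) θ := by
  have h1 : HasDerivAt (fun θ : ℝ => (-Real.sin θ) • n) ((-Real.cos θ) • n) θ :=
    (Real.hasDerivAt_sin θ).neg.smul_const n
  have h2 : HasDerivAt (fun θ : ℝ => Real.cos θ • ρ) ((-Real.sin θ) • ρ) θ := (Real.hasDerivAt_cos θ).smul_const ρ
  exact (h1.add h2).congr_deriv (by module)

end Summit.NavierStokesRegularity.NavierStokesRegularity.Theorems.PoloidalLiouville.FluxStarvedDipole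

end
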